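import Mathlib
import Summits.Ventures.PercRepro2.A3CutCrossFMSums
import Summits.Ventures.PercRepro2.A3CutOBehind

/-!
# The cross-shield, (FM): each factor of `FMfun(x) = 2 A₁ X Y / P(Q)²` is a Harris inequality
(blind cell PercRepro2, night-1 g33; proofs/NIGHT1-G33.md §7; census 198/198 for `X ≥ 0`, `Y ≥ 0` —
mining/night-1/g33/check_cross_fm.py)

Identifying the atoms of A3CutCrossFMSums with the side events `I = {x ↔_A a₁}`, `J = {a₁ ↔_A o}`
(`A₁ = P(I)`, `A₀ = P(Iᶜ)`, `Ao₁ = P(I ∩ J)`, `Aρ₀ = P(Iᶜ ∩ J)`: `sum_alpha_mem`, `sum_alpha_notMem`) and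
`I' = {x ↔_B a₂}`, `J' = {a₂ ↔_B b}` (`sum_mu_mem`, `sum_mu_notMem`), each bracket is ONE Harris
inequality: `P(I ∩ J) P(Iᶜ) − P(I) P(Iᶜ ∩ J) = P(I ∩ J) − P(I) P(J) ≥ 0` (`harris_diff_nonneg`, the cell's
`prob_mul_prob_le_prob_inter`), so `X ≥ 0` (`X_core_nonneg`), `Y ≥ 0` (`Y_core_nonneg`) and
**`FM_cross`**: (FM) holds at `x` in the cross-shield class.  Standard axioms.
-/

namespace Summit.Ventures.PercRepro2

open UnionCluster CovForm CutV

namespace CovForm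

namespace A3Fibre

namespace CrossShield

section FM

variable {V : Type*} {E : Type*} [Fintype V] [DecidableEq V] [Fintype E] [DecidableEq E]
  {R : Type*} [Field R] [LinearOrder R] [IsStrictOrderedRing R] {ends : E → Sym2 V} {x : V}
  {VA VB : Finset V} {EA EB : Set E} [DecidablePred (· ∈ EA)] [DecidablePred (· ∈ EB)] {p : E → R}
  {a₁ a₂ o b : V}

/-! ## Harris on each side -/

omit [Fintype V] [DecidableEq V] [Fintype E] [DecidableEq E] [Field R] [LinearOrder R]
  [IsStrictOrderedRing R] [DecidablePred (· ∈ EA)] [DecidablePred (· ∈ EB)] in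
/-- `restrict F` is monotone. -/
lemma restrict_mono_cs (F : Set E) [DecidablePred (· ∈ F)] {ω ω' : Config E} (hle : ω ≤ ω') :
    restrict F ω ≤ restrict F ω' := by
  intro e
  by_cases he : e ∈ F
  · rw [restrict_apply_of_mem he, restrict_apply_of_mem he]
    exact hle e
  · rw [restrict_apply_of_notMem he, restrict_apply_of_notMem he]

omit [Fintype V] [DecidableEq V] [Fintype E] [DecidableEq E] [Field R] [LinearOrder R]
  [IsStrictOrderedRing R] [DecidablePred (· ∈ EA)] [DecidablePred (· ∈ EB)] in
/-- A side event of an increasing event is increasing. -/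
lemma isUpperSet_sideEvent_cs (F : Set E) [DecidablePred (· ∈ F)] {A : Set (Config E)}
    (hA : IsUpperSet A) : IsUpperSet (sideEvent F A) :=
  fun _ _ hle hω => hA (restrict_mono_cs F hle) hω

omit [Fintype V] [DecidableEq V] [DecidablePred (· ∈ EA)] [DecidablePred (· ∈ EB)] in
/-- **The Harris difference**: `P(I ∩ J) P(Iᶜ) − P(I) P(Iᶜ ∩ J) = P(I ∩ J) − P(I) P(J) ≥ 0` for
increasing `I`, `J`. -/
lemma harris_diff_nonneg (hp : IsProbVec p) {I J : Set (Config E)} (hI : IsUpperSet I)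
    (hJ : IsUpperSet J) :
    0 ≤ prob p (I ∩ J) * prob p Iᶜ - prob p I * prob p (Iᶜ ∩ J) := by
  have h1 := prob_inter_add_prob_inter_compl p J I
  have h2 := prob_compl p I
  have h3 := prob_mul_prob_le_prob_inter hp hI hJ
  rw [Set.inter_comm J I] at h1
  rw [show Iᶜ ∩ J = J ∩ Iᶜ from Set.inter_comm _ _, h2,
    show prob p (J ∩ Iᶜ) = prob p J - prob p (I ∩ J) by linarith,
    show prob p (I ∩ J) * (1 - prob p I) - prob p I * (prob p J - prob p (I ∩ J)) =
      prob p (I ∩ J) - prob p I * prob p J by ring]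
  linarith

omit [Fintype V] [Fintype E] [DecidableEq E] [Field R] [LinearOrder R] [IsStrictOrderedRing R]
  [DecidablePred (· ∈ EA)] [DecidablePred (· ∈ EB)] in
/-- On `{C(x) = insert x S}`, `x ↔ y` iff `y ∈ S` for `y ∈ VA` (any configuration). -/
lemma conn_iff_mem_of_cluster_insert (h : IsCut ends x ↑VA ↑VB EA EB) {y : V} (hy : y ∈ VA)
    {ω' : Config E} {S : Finset V} (hW : cluster ends ω' x = ↑(insert x S)) :
    Conn ends ω' x y ↔ y ∈ S := by
  have hyx : y ≠ x := fun hc => h.x_notA (Finset.mem_coe.2 (hc ▸ hy))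
  constructor
  · intro hc
    have : y ∈ cluster ends ω' x := hc
    rw [hW] at this
    rcases Finset.mem_insert.1 (Finset.mem_coe.1 this) with hc' | hc'
    · exact absurd hc' hyx
    · exact hc'
  · intro hyS
    have : y ∈ cluster ends ω' x := by
      rw [hW]; exact Finset.mem_coe.2 (Finset.mem_insert_of_mem hyS)
    exact this

omit [LinearOrder R] [IsStrictOrderedRing R] [DecidablePred (· ∈ EB)] in
/-- The `A`-atoms as side-event probabilities: `∑_{S ∋ a₁} f(S) = ∑_S P_A(C_A(x) = insert x S, x ↔ a₁, …)`.
Generic form: for an `A`-side event `Z`, the sum over `S ∋ a₁` of `P_A(C_A(x) = insert x S, Z)` is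
`P_A(x ↔ a₁, Z)`, and over `S ∌ a₁` it is `P_A(x ↮ a₁, Z)`. -/
lemma sum_alpha_mem (h : IsCut ends x ↑VA ↑VB EA EB) (ha1 : a₁ ∈ VA) (Z : Set (Config E)) :
    ∑ S ∈ VA.powerset.filter (fun S => a₁ ∈ S),
        prob p (sideEvent EA (clusterEvent ends x (↑(insert x S) : Set V) ∩ Z)) =
      prob p (sideEvent EA (connEvent ends x a₁ ∩ Z)) := by
  rw [← sum_prob_sideA_cluster_inter p h (connEvent ends x a₁ ∩ Z), Finset.sum_filter]
  refine Finset.sum_congr rfl fun S _ => ?_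
  by_cases h1 : a₁ ∈ S
  · rw [if_pos h1]
    have e : clusterEvent ends x (↑(insert x S) : Set V) ∩ (connEvent ends x a₁ ∩ Z) =
        clusterEvent ends x (↑(insert x S) : Set V) ∩ Z := by
      ext ω
      simp only [Set.mem_inter_iff, mem_clusterEvent, mem_connEvent]
      constructor
      · rintro ⟨hW, _, hZ⟩
        exact ⟨hW, hZ⟩
      · rintro ⟨hW, hZ⟩
        exact ⟨hW, (conn_iff_mem_of_cluster_insert h ha1 hW).2 h1, hZ⟩
    rw [e]
  · rw [if_neg h1]
    have e : clusterEvent ends x (↑(insert x S) : Set V) ∩ (connEvent ends x a₁ ∩ Z) = ∅ := by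
      ext ω
      simp only [Set.mem_inter_iff, mem_clusterEvent, mem_connEvent, Set.mem_empty_iff_false,
        iff_false, not_and]
      intro hW hc _
      exact h1 ((conn_iff_mem_of_cluster_insert h ha1 hW).1 hc)
    rw [e, RootShield.sideEvent_empty, prob_empty]

omit [LinearOrder R] [IsStrictOrderedRing R] [DecidablePred (· ∈ EB)] in
/-- The sum over `S ∌ a₁` of `P_A(C_A(x) = insert x S, Z)` is `P_A(x ↮ a₁, Z)`. -/
lemma sum_alpha_notMem (h : IsCut ends x ↑VA ↑VB EA EB) (ha1 : a₁ ∈ VA) (Z : Set (Config E)) :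
    ∑ S ∈ VA.powerset.filter (fun S => a₁ ∉ S),
        prob p (sideEvent EA (clusterEvent ends x (↑(insert x S) : Set V) ∩ Z)) =
      prob p (sideEvent EA ((connEvent ends x a₁)ᶜ ∩ Z)) := by
  rw [← sum_prob_sideA_cluster_inter p h ((connEvent ends x a₁)ᶜ ∩ Z), Finset.sum_filter]
  refine Finset.sum_congr rfl fun S _ => ?_
  by_cases h1 : a₁ ∉ S
  · rw [if_pos h1]
    have e : clusterEvent ends x (↑(insert x S) : Set V) ∩ ((connEvent ends x a₁)ᶜ ∩ Z) =
        clusterEvent ends x (↑(insert x S) : Set V) ∩ Z := by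
      ext ω
      simp only [Set.mem_inter_iff, mem_clusterEvent, Set.mem_compl_iff, mem_connEvent]
      constructor
      · rintro ⟨hW, _, hZ⟩
        exact ⟨hW, hZ⟩
      · rintro ⟨hW, hZ⟩
        exact ⟨hW, fun hc => h1 ((conn_iff_mem_of_cluster_insert h ha1 hW).1 hc), hZ⟩
    rw [e]
  · rw [if_neg h1]
    have h1' : a₁ ∈ S := not_not.1 h1
    have e : clusterEvent ends x (↑(insert x S) : Set V) ∩ ((connEvent ends x a₁)ᶜ ∩ Z) = ∅ := by
      ext ω
      simp only [Set.mem_inter_iff, mem_clusterEvent, Set.mem_compl_iff, mem_connEvent,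
        Set.mem_empty_iff_false, iff_false, not_and]
      intro hW hc _
      exact hc ((conn_iff_mem_of_cluster_insert h ha1 hW).2 h1')
    rw [e, RootShield.sideEvent_empty, prob_empty]

omit [Fintype V] [DecidableEq V] [Fintype E] [DecidableEq E] [Field R] [LinearOrder R]
  [IsStrictOrderedRing R] [DecidablePred (· ∈ EA)] [DecidablePred (· ∈ EB)] in
/-- Side events intersect inside the side (complement form). -/
lemma sideEvent_compl_cs (F : Set E) [DecidablePred (· ∈ F)] (A : Set (Config E)) :
    sideEvent F Aᶜ = (sideEvent F A)ᶜ := rfl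

omit [DecidablePred (· ∈ EB)] in
/-- **`X ≥ 0`**: `A₀ Ao₁ − A₁ Aρ₀ ≥ 0` by Harris on the `A`-side. -/
lemma X_core_nonneg (hp : IsProbVec p) (h : IsCut ends x ↑VA ↑VB EA EB) (ha1 : a₁ ∈ VA) (o : V) :
    0 ≤ (∑ S ∈ VA.powerset.filter (fun S => a₁ ∉ S), alphaS p ends EA x S) *
          (∑ S ∈ VA.powerset.filter (fun S => a₁ ∈ S), alphaO p ends EA x a₁ o S) -
        (∑ S ∈ VA.powerset.filter (fun S => a₁ ∈ S), alphaS p ends EA x S) *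
          (∑ S ∈ VA.powerset.filter (fun S => a₁ ∉ S), alphaO p ends EA x a₁ o S) := by
  have hA1 : ∑ S ∈ VA.powerset.filter (fun S => a₁ ∈ S), alphaS p ends EA x S =
      prob p (sideEvent EA (connEvent ends x a₁)) := by
    have key := sum_alpha_mem (p := p) h ha1 Set.univ
    simp only [Set.inter_univ] at key
    exact key
  have hA0 : ∑ S ∈ VA.powerset.filter (fun S => a₁ ∉ S), alphaS p ends EA x S =
      prob p (sideEvent EA (connEvent ends x a₁))ᶜ := by
    have key := sum_alpha_notMem (p := p) h ha1 Set.univ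
    simp only [Set.inter_univ] at key
    rw [← sideEvent_compl_cs]
    exact key
  have hAo1 : ∑ S ∈ VA.powerset.filter (fun S => a₁ ∈ S), alphaO p ends EA x a₁ o S =
      prob p (sideEvent EA (connEvent ends x a₁) ∩ sideEvent EA (connEvent ends a₁ o)) := by
    rw [sideEvent_inter]
    exact sum_alpha_mem (p := p) h ha1 (connEvent ends a₁ o)
  have hAr : ∑ S ∈ VA.powerset.filter (fun S => a₁ ∉ S), alphaO p ends EA x a₁ o S =
      prob p ((sideEvent EA (connEvent ends x a₁))ᶜ ∩ sideEvent EA (connEvent ends a₁ o)) := by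
    rw [← sideEvent_compl_cs, sideEvent_inter]
    exact sum_alpha_notMem (p := p) h ha1 (connEvent ends a₁ o)
  rw [hA1, hA0, hAo1, hAr]
  have key := harris_diff_nonneg hp (isUpperSet_sideEvent_cs EA (isUpperSet_connEvent ends x a₁))
    (isUpperSet_sideEvent_cs EA (isUpperSet_connEvent ends a₁ o))
  linarith

omit [LinearOrder R] [IsStrictOrderedRing R] [DecidablePred (· ∈ EA)] in
/-- The `B`-atoms: `∑_{T ∋ a₂} P_B(C_B(x) = T, Z) = P_B(x ↔ a₂, Z)`. -/
lemma sum_mu_mem (h : IsCut ends x ↑VA ↑VB EA EB) (ha2 : a₂ ∈ insert x VB) (Z : Set (Config E)) :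
    ∑ T ∈ ((insert x VB).powerset.filter (fun T => x ∈ T)).filter (fun T => a₂ ∈ T),
        prob p (sideEvent EB (clusterEvent ends x (↑T : Set V) ∩ Z)) =
      prob p (sideEvent EB (connEvent ends x a₂ ∩ Z)) := by
  rw [← sum_prob_sideB_cluster_TT h (connEvent ends x a₂ ∩ Z), Finset.sum_filter]
  refine Finset.sum_congr rfl fun T _ => ?_
  have _ := ha2
  by_cases h2 : a₂ ∈ T
  · rw [if_pos h2]
    have e : clusterEvent ends x (↑T : Set V) ∩ (connEvent ends x a₂ ∩ Z) =
        clusterEvent ends x (↑T : Set V) ∩ Z := by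
      ext ω
      simp only [Set.mem_inter_iff, mem_clusterEvent, mem_connEvent]
      constructor
      · rintro ⟨hW, _, hZ⟩
        exact ⟨hW, hZ⟩
      · rintro ⟨hW, hZ⟩
        refine ⟨hW, ?_, hZ⟩
        have : a₂ ∈ cluster ends ω x := by rw [hW]; exact Finset.mem_coe.2 h2
        exact this
    rw [e]
  · rw [if_neg h2]
    have e : clusterEvent ends x (↑T : Set V) ∩ (connEvent ends x a₂ ∩ Z) = ∅ := by
      ext ω
      simp only [Set.mem_inter_iff, mem_clusterEvent, mem_connEvent, Set.mem_empty_iff_false,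
        iff_false, not_and]
      intro hW hc _
      apply h2
      have : a₂ ∈ cluster ends ω x := hc
      rw [hW] at this
      exact Finset.mem_coe.1 this
    rw [e, RootShield.sideEvent_empty, prob_empty]

omit [LinearOrder R] [IsStrictOrderedRing R] [DecidablePred (· ∈ EA)] in
/-- The `B`-atoms: `∑_{T ∌ a₂} P_B(C_B(x) = T, Z) = P_B(x ↮ a₂, Z)`. -/
lemma sum_mu_notMem (h : IsCut ends x ↑VA ↑VB EA EB) (ha2 : a₂ ∈ insert x VB)
    (Z : Set (Config E)) :
    ∑ T ∈ ((insert x VB).powerset.filter (fun T => x ∈ T)).filter (fun T => a₂ ∉ T),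
        prob p (sideEvent EB (clusterEvent ends x (↑T : Set V) ∩ Z)) =
      prob p (sideEvent EB ((connEvent ends x a₂)ᶜ ∩ Z)) := by
  rw [← sum_prob_sideB_cluster_TT h ((connEvent ends x a₂)ᶜ ∩ Z), Finset.sum_filter]
  refine Finset.sum_congr rfl fun T _ => ?_
  have _ := ha2
  by_cases h2 : a₂ ∉ T
  · rw [if_pos h2]
    have e : clusterEvent ends x (↑T : Set V) ∩ ((connEvent ends x a₂)ᶜ ∩ Z) =
        clusterEvent ends x (↑T : Set V) ∩ Z := by
      ext ω
      simp only [Set.mem_inter_iff, mem_clusterEvent, Set.mem_compl_iff, mem_connEvent]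
      constructor
      · rintro ⟨hW, _, hZ⟩
        exact ⟨hW, hZ⟩
      · rintro ⟨hW, hZ⟩
        refine ⟨hW, fun hc => h2 ?_, hZ⟩
        have : a₂ ∈ cluster ends ω x := hc
        rw [hW] at this
        exact Finset.mem_coe.1 this
    rw [e]
  · rw [if_neg h2]
    have h2' : a₂ ∈ T := not_not.1 h2
    have e : clusterEvent ends x (↑T : Set V) ∩ ((connEvent ends x a₂)ᶜ ∩ Z) = ∅ := by
      ext ω
      simp only [Set.mem_inter_iff, mem_clusterEvent, Set.mem_compl_iff, mem_connEvent,
        Set.mem_empty_iff_false, iff_false, not_and]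
      intro hW hc _
      apply hc
      have : a₂ ∈ cluster ends ω x := by rw [hW]; exact Finset.mem_coe.2 h2'
      exact this
    rw [e, RootShield.sideEvent_empty, prob_empty]

omit [DecidablePred (· ∈ EA)] in
/-- **`Y ≥ 0`**: `Bβ₂ B₀ − B₂ Bβ₀ ≥ 0` by Harris on the `B`-side. -/
lemma Y_core_nonneg (hp : IsProbVec p) (h : IsCut ends x ↑VA ↑VB EA EB) (ha2 : a₂ ∈ insert x VB)
    (b : V) :
    0 ≤ (∑ T ∈ ((insert x VB).powerset.filter (fun T => x ∈ T)).filter (fun T => a₂ ∈ T),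
            muB p ends EB x a₂ b T) *
          (∑ T ∈ ((insert x VB).powerset.filter (fun T => x ∈ T)).filter (fun T => a₂ ∉ T),
            muT p ends EB x T) -
        (∑ T ∈ ((insert x VB).powerset.filter (fun T => x ∈ T)).filter (fun T => a₂ ∈ T),
            muT p ends EB x T) *
          (∑ T ∈ ((insert x VB).powerset.filter (fun T => x ∈ T)).filter (fun T => a₂ ∉ T),
            muB p ends EB x a₂ b T) := by
  have hB2 : ∑ T ∈ ((insert x VB).powerset.filter (fun T => x ∈ T)).filter (fun T => a₂ ∈ T),
      muT p ends EB x T = prob p (sideEvent EB (connEvent ends x a₂)) := by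
    have key := sum_mu_mem (p := p) h ha2 Set.univ
    simp only [Set.inter_univ] at key
    exact key
  have hB0 : ∑ T ∈ ((insert x VB).powerset.filter (fun T => x ∈ T)).filter (fun T => a₂ ∉ T),
      muT p ends EB x T = prob p (sideEvent EB (connEvent ends x a₂))ᶜ := by
    have key := sum_mu_notMem (p := p) h ha2 Set.univ
    simp only [Set.inter_univ] at key
    rw [← sideEvent_compl_cs]
    exact key
  have hBb2 : ∑ T ∈ ((insert x VB).powerset.filter (fun T => x ∈ T)).filter (fun T => a₂ ∈ T),
      muB p ends EB x a₂ b T =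
      prob p (sideEvent EB (connEvent ends x a₂) ∩ sideEvent EB (connEvent ends a₂ b)) := by
    rw [sideEvent_inter]
    exact sum_mu_mem (p := p) h ha2 (connEvent ends a₂ b)
  have hBb0 : ∑ T ∈ ((insert x VB).powerset.filter (fun T => x ∈ T)).filter (fun T => a₂ ∉ T),
      muB p ends EB x a₂ b T =
      prob p ((sideEvent EB (connEvent ends x a₂))ᶜ ∩ sideEvent EB (connEvent ends a₂ b)) := by
    rw [← sideEvent_compl_cs, sideEvent_inter]
    exact sum_mu_notMem (p := p) h ha2 (connEvent ends a₂ b)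
  rw [hB2, hB0, hBb2, hBb0]
  have key := harris_diff_nonneg hp (isUpperSet_sideEvent_cs EB (isUpperSet_connEvent ends x a₂))
    (isUpperSet_sideEvent_cs EB (isUpperSet_connEvent ends a₂ b))
  linarith

/-- **(FM) at `x` in the cross-shield class**: `FMfun(x) ≥ 0` by Harris on each side. -/
theorem FM_cross (hp : IsProbVec p) (h : IsCut ends x ↑VA ↑VB EA EB) (ha1 : a₁ ∈ VA) (ho : o ∈ VA)
    (ha2 : a₂ ∈ insert x VB) (hb : b ∈ insert x VB) : FM p ends o a₁ a₂ x b := by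
  unfold FM
  by_cases hQ : prob p (avoidAll ends a₂ {a₁}) = 0
  · rw [CutOBehind.FMfun_eq_zero_of_Q_eq_zero' hp o x b hQ]
  rw [FMfun_cross_eq hp h ha1 ho ha2 hb hQ]
  have hA1 : 0 ≤ ∑ S ∈ VA.powerset.filter (fun S => a₁ ∈ S), alphaS p ends EA x S :=
    Finset.sum_nonneg fun S _ => prob_nonneg hp _
  have hA0 : 0 ≤ ∑ S ∈ VA.powerset.filter (fun S => a₁ ∉ S), alphaS p ends EA x S :=
    Finset.sum_nonneg fun S _ => prob_nonneg hp _
  have hAo0 : 0 ≤ ∑ S ∈ VA.powerset.filter (fun S => a₁ ∉ S),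
      (if o ∈ S then alphaS p ends EA x S else 0) :=
    Finset.sum_nonneg fun S _ => by
      split_ifs
      · exact prob_nonneg hp _
      · exact le_rfl
  have hB0 : 0 ≤ ∑ T ∈ ((insert x VB).powerset.filter (fun T => x ∈ T)).filter (fun T => a₂ ∉ T),
      muT p ends EB x T := Finset.sum_nonneg fun T _ => prob_nonneg hp _
  have hB2 : 0 ≤ ∑ T ∈ ((insert x VB).powerset.filter (fun T => x ∈ T)).filter (fun T => a₂ ∈ T),
      muT p ends EB x T := Finset.sum_nonneg fun T _ => prob_nonneg hp _
  have hBb : 0 ≤ ∑ T ∈ ((insert x VB).powerset.filter (fun T => x ∈ T)).filter (fun T => a₂ ∉ T),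
      (if b ∈ T then muT p ends EB x T else 0) :=
    Finset.sum_nonneg fun T _ => by
      split_ifs
      · exact prob_nonneg hp _
      · exact le_rfl
  have hX := X_core_nonneg hp h ha1 o
  have hY := Y_core_nonneg hp h ha2 b
  apply div_nonneg _ (sq_nonneg _)
  apply mul_nonneg (mul_nonneg (mul_nonneg (by norm_num) hA1) ?_) ?_
  · exact add_nonneg (mul_nonneg hB0 hX) (mul_nonneg (mul_nonneg hB2 hA0) hAo0)
  · rw [mul_sub]
    linarith [hY, mul_nonneg hB2 hBb]

end FM

end CrossShield

end A3Fibre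

end CovForm

end Summit.Ventures.PercRepro2
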